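import Summits.BirchSwinnertonDyer.Rank2.Chi8FloorTwistDoorFinal
import HarnessLib

/-!
# The χ₈-floor kernel, Part H of 8 — §TwistDoorConductorLevel, §TwistDoorAnalyticAnyLevel

Planner p2 GEN 40–42 kernel `Chi8Floor` v10 (cell bsd-rank2, HOME/p2/g43/lean/Chi8Floor_v10.lean, sha bc257584; 60 theorems, `lean check` rc 0 / 0 sorry),
split into ≤400-line tree files `Rank2/Chi8Floor{Certificate,ConductorLevel,TwistDoor,LatticeEngine,TwistDoorProved,PeriodFree,TwistDoorFinal,KatoFree}`
(A–H, a linear import chain) by the lead star-p1 GEN 18 at the planner's LANDING ASK.  The mathematical overview, the honest framing (Barrier B1: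
`ord_{T=0} L₂` is the 2-adic analytic order, never `r_an`; BSD is not proved) and the references are in Part A's module docstring
(`Rank2/Chi8FloorCertificate.lean`); every theorem below carries its own `[cite: …]` tags.  Theorems only; no definition, no named fact, no instance.
[cite: MazurTateTeitelbaum1986Invent, §I.14 Proposition (p. 20)] [cite: Kato2004Asterisque, Thm. 18.4 (p. 281)] [cite: GreenbergLNM1716, §5 (p. 181)]
[cite: Stevens1989, Lemma (5.4)]
-/

noncomputable section

open PowerSeries WeierstrassCurve CongruenceSubgroup Filter
open Literature.NumberTheory.EllipticCurves Literature.NumberTheory.EllipticCurves.ModularForms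
open Literature.Barriers.BirchSwinnertonDyer

namespace Summit.BirchSwinnertonDyer.Rank2

section TwistDoorConductorLevel

/-! ### Kato-free exact order on the door (conductor level)

At the conductor level `N_E = N₀q²` of the twist `E = E₀^{(q)}` the `2`-adic functional equation
(`rootNumber_eq_neg_one_pow_order_padicLFunction_conductorLevel_anyPrime`) makes `ord_{T=0} L₂(E,T)`
even when `w_E = +1`; with `L(E,1) = 0` (`ord ≥ 1`) and the lattice-engine floor (`ord ≤ 2`) this pins
`ord_{T=0} L₂(E,T) = 2` with NO Kato input and NO planted points. A `2`-descent certificate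
`rank E(ℚ) = 2 ∧ Ш(E)[2] = 0` (pari `ellrank = [2,2]`; kit j326901: 152 door instances, 7 bases) then gives
the rank statement of `2`-adic BSD `ord_T L₂ = rank = corank Sel_{2^∞} = 2` for that curve outright. -/

variable {N₀ : ℕ} [NeZero N₀] {q : ℕ} [NeZero q]
variable {W : WeierstrassCurve ℚ} [W.IsElliptic] [W.IsGloballyMinimal] [NeZero (W.conductorNorm ℤ)]

/-- **Kato-free exact order on the door (parity form, conductor level).** Under the streamlined engine
hypotheses for `F = f₀ ⊗ χ_q` at level `N_E`, `w_E = +1` and `L(E,1) = 0`:  `ord_{T=0} L₂(E,T) = 2`.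
[cite: MazurTateTeitelbaum1986Invent, §I.8, §I.14 Proposition (p. 20), §I.17–18] -/
theorem order_padicLFunction_eq_two_of_twistedEighth_forcedZeros'
    (hN : N₀ ∣ W.conductorNorm ℤ) (hm : q ^ 2 ∣ W.conductorNorm ℤ)
    {χ : DirichletCharacter ℂ q} (hχ : χ.IsQuadratic) (hχe : χ.Even) (hχp : χ.IsPrimitive)
    {f₀ : CuspForm (Gamma0 N₀) 2} (hf₀ : IsNewform0 f₀) (hQ₀ : coeffField f₀ = ⊥) (hN2 : ¬ 2 ∣ N₀)
    (hL2 : ¬ 2 ∣ W.conductorNorm ℤ) (hord : IsOrdinaryAt W 2)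
    (hF : IsNewformOf W (charTwist (W.conductorNorm ℤ) hN hm hχ f₀))
    (hw : W.rootNumber = 1) (hL : W.entireLFunction 1 = 0)
    (hper : ∃ u : ℚ, ‖(u : ℚ_[2])‖ = 1 ∧
      (u : ℂ) * (plusPeriod (charTwist (W.conductorNorm ℤ) hN hm hχ f₀) : ℂ) *
        gaussSum χ (ZMod.stdAddChar (N := q)) = (plusPeriod f₀ : ℂ))
    (hq : q.Prime) (hq2 : q ≠ 2) (hqN : ¬ q ∣ N₀) {a : ℤ} (ha : cuspCoeff f₀ q = a) (hodd : Odd a)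
    {a₂ : ℤ} (ha₂ : cuspCoeff f₀ 2 = a₂)
    (h18 : ‖((ratPlusSymbol f₀ (1 / 8) : ℚ) : ℚ_[2])‖ = 1)
    (hL0 : modularSymbol f₀ 0 = 0)
    (h4 : modularSymbol f₀ (1 / 4) - modularSymbol f₀ (3 / 4) = 0)
    (h8m : modularSymbol f₀ (1 / 8) + modularSymbol f₀ (3 / 8) - modularSymbol f₀ (5 / 8)
      - modularSymbol f₀ (7 / 8) = 0)
    (h4F : modularSymbol (charTwist (W.conductorNorm ℤ) hN hm hχ f₀) (1 / 4)
      - modularSymbol (charTwist (W.conductorNorm ℤ) hN hm hχ f₀) (3 / 4) = 0)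
    (h8F : modularSymbol (charTwist (W.conductorNorm ℤ) hN hm hχ f₀) (1 / 8)
      + modularSymbol (charTwist (W.conductorNorm ℤ) hN hm hχ f₀) (3 / 8)
      - modularSymbol (charTwist (W.conductorNorm ℤ) hN hm hχ f₀) (5 / 8)
      - modularSymbol (charTwist (W.conductorNorm ℤ) hN hm hχ f₀) (7 / 8) = 0)
    (hΛ : ∀ z ∈ periodLattice f₀, z.im = 0 → ∃ k : ℤ, z = k * (plusPeriod f₀ : ℂ)) :
    (padicLFunction (charTwist (W.conductorNorm ℤ) hN hm hχ f₀) (unitRoot W 2 : ℚ_[2])).order = 2 := by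
  obtain ⟨ε, hε, hε0, hεodd⟩ := exists_int_eq_of_isQuadratic hχ hq
  have hg := im_gaussSum_eq_zero_of_isQuadratic_of_even hχ hχp hχe hq
  have h0 := ratPlusSymbol_zero_eq_zero_of_modularSymbol hf₀ hQ₀ hL0
  have h8q : ‖((ratPlusSymbol f₀ ((q : ℚ) / 8) : ℚ) : ℚ_[2])‖ = 1 := by
    rw [norm_ratPlusSymbol_div_eight_eq hf₀ hQ₀ hN2 ha₂ h0 (hq.odd_of_ne_two hq2), h18]
  have hM := norm_qnrHalfSum_le_half_of_forcedZeros (W.conductorNorm ℤ) hN hm hχ hχp hf₀ hQ₀ hN2 hL2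
    hF.1 hF.coeffField_eq_bot ε hε hε0 hεodd hq hq2 hqN ha hL0 h4 h8m h4F h8F hg hΛ
  have h1 := norm_ratPlusSymbol_charTwist_eighth_eq_one (W.conductorNorm ℤ) hN hm hχ hχe hχp hf₀ hQ₀
    hF.1 hF.coeffField_eq_bot ε hε hper hq hq2 hqN ha hodd h8q h18.le hM
  have h8' : (2 : ℝ)⁻¹ ^ 2 <
      ‖((ratPlusSymbol (charTwist (W.conductorNorm ℤ) hN hm hχ f₀) (1 / 8) : ℚ) : ℚ_[2])‖ := by
    rw [h1]; norm_num
  exact order_padicLFunction_eq_two_of_eighthSymbol₀ hord hF hw hL h8'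

/-- **Descent form of the door (no Kato).** If moreover a `2`-descent gives `rank E(ℚ) = 2` and
`corank Ш(E)[2^∞] = 0` (e.g. `Ш(E)[2] = 0`), then `corank Sel_{2^∞}(E) = 2 = ord_{T=0} L₂(E,T) = rank E(ℚ)`:
the rank statement of `2`-adic BSD for `E`, from the descent and the lattice engine alone.
[cite: MazurTateTeitelbaum1986Invent, §I.8, §I.14] [cite: Greenberg1999LNM, §1 pp. 54–57] -/
theorem twoAdicBSD_rank_of_twistedEighth_descent
    (hN : N₀ ∣ W.conductorNorm ℤ) (hm : q ^ 2 ∣ W.conductorNorm ℤ)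
    {χ : DirichletCharacter ℂ q} (hχ : χ.IsQuadratic) (hχe : χ.Even) (hχp : χ.IsPrimitive)
    {f₀ : CuspForm (Gamma0 N₀) 2} (hf₀ : IsNewform0 f₀) (hQ₀ : coeffField f₀ = ⊥) (hN2 : ¬ 2 ∣ N₀)
    (hL2 : ¬ 2 ∣ W.conductorNorm ℤ) (hord : IsOrdinaryAt W 2)
    (hF : IsNewformOf W (charTwist (W.conductorNorm ℤ) hN hm hχ f₀))
    (hw : W.rootNumber = 1) (hL : W.entireLFunction 1 = 0)
    (hper : ∃ u : ℚ, ‖(u : ℚ_[2])‖ = 1 ∧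
      (u : ℂ) * (plusPeriod (charTwist (W.conductorNorm ℤ) hN hm hχ f₀) : ℂ) *
        gaussSum χ (ZMod.stdAddChar (N := q)) = (plusPeriod f₀ : ℂ))
    (hq : q.Prime) (hq2 : q ≠ 2) (hqN : ¬ q ∣ N₀) {a : ℤ} (ha : cuspCoeff f₀ q = a) (hodd : Odd a)
    {a₂ : ℤ} (ha₂ : cuspCoeff f₀ 2 = a₂)
    (h18 : ‖((ratPlusSymbol f₀ (1 / 8) : ℚ) : ℚ_[2])‖ = 1)
    (hL0 : modularSymbol f₀ 0 = 0)
    (h4 : modularSymbol f₀ (1 / 4) - modularSymbol f₀ (3 / 4) = 0)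
    (h8m : modularSymbol f₀ (1 / 8) + modularSymbol f₀ (3 / 8) - modularSymbol f₀ (5 / 8)
      - modularSymbol f₀ (7 / 8) = 0)
    (h4F : modularSymbol (charTwist (W.conductorNorm ℤ) hN hm hχ f₀) (1 / 4)
      - modularSymbol (charTwist (W.conductorNorm ℤ) hN hm hχ f₀) (3 / 4) = 0)
    (h8F : modularSymbol (charTwist (W.conductorNorm ℤ) hN hm hχ f₀) (1 / 8)
      + modularSymbol (charTwist (W.conductorNorm ℤ) hN hm hχ f₀) (3 / 8)
      - modularSymbol (charTwist (W.conductorNorm ℤ) hN hm hχ f₀) (5 / 8)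
      - modularSymbol (charTwist (W.conductorNorm ℤ) hN hm hχ f₀) (7 / 8) = 0)
    (hΛ : ∀ z ∈ periodLattice f₀, z.im = 0 → ∃ k : ℤ, z = k * (plusPeriod f₀ : ℂ))
    (hrank : W.mordellWeilRank = 2) (hsha : W.shaCorank 2 = 0) :
    W.selmerCorank 2 = 2 ∧
      (padicLFunction (charTwist (W.conductorNorm ℤ) hN hm hχ f₀) (unitRoot W 2 : ℚ_[2])).order = 2 ∧
      W.mordellWeilRank = 2 := by
  refine ⟨?_, ?_, hrank⟩
  · have hkum := W.selmerCorank_eq_mordellWeilRank_add_holds 2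
    rw [hkum, hrank, hsha]
  · exact order_padicLFunction_eq_two_of_twistedEighth_forcedZeros' hN hm hχ hχe hχp hf₀ hQ₀ hN2 hL2
      hord hF hw hL hper hq hq2 hqN ha hodd ha₂ h18 hL0 h4 h8m h4F h8F hΛ

/-- **The Kato-free door with ANALYTIC inputs (conductor level).** Same as
`order_padicLFunction_eq_two_of_twistedEighth_forcedZeros'` with the five symbol hypotheses replaced by
central `L`-value vanishings: `L(f₀,1) = 0`, `L(f₀,χ₋₄,1) = L(f₀,χ₋₈,1) = 0`, `L(F,χ₋₄,1) = L(F,χ₋₈,1) = 0`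
(each for some — equivalently every — entire continuation), i.e. `L(E₀,1) = 0` and the four sign-forced
zeros `L(E₀^{(−1)},1) = L(E₀^{(−2)},1) = L(E^{(−1)},1) = L(E^{(−2)},1) = 0`. Conclusion: `ord_{T=0} L₂(E,T) = 2`.
[cite: MazurTateTeitelbaum1986Invent, §I.8 (8.6), §I.14, §I.17–18] [cite: Birch1971] -/
theorem order_padicLFunction_eq_two_of_twistedEighth_analytic
    (hN : N₀ ∣ W.conductorNorm ℤ) (hm : q ^ 2 ∣ W.conductorNorm ℤ)
    {χ : DirichletCharacter ℂ q} (hχ : χ.IsQuadratic) (hχe : χ.Even) (hχp : χ.IsPrimitive)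
    {f₀ : CuspForm (Gamma0 N₀) 2} (hf₀ : IsNewform0 f₀) (hQ₀ : coeffField f₀ = ⊥) (hN2 : ¬ 2 ∣ N₀)
    (hL2 : ¬ 2 ∣ W.conductorNorm ℤ) (hord : IsOrdinaryAt W 2)
    (hF : IsNewformOf W (charTwist (W.conductorNorm ℤ) hN hm hχ f₀))
    (hw : W.rootNumber = 1) (hL : W.entireLFunction 1 = 0)
    (hper : ∃ u : ℚ, ‖(u : ℚ_[2])‖ = 1 ∧
      (u : ℂ) * (plusPeriod (charTwist (W.conductorNorm ℤ) hN hm hχ f₀) : ℂ) *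
        gaussSum χ (ZMod.stdAddChar (N := q)) = (plusPeriod f₀ : ℂ))
    (hq : q.Prime) (hq2 : q ≠ 2) (hqN : ¬ q ∣ N₀) {a : ℤ} (ha : cuspCoeff f₀ q = a) (hodd : Odd a)
    {a₂ : ℤ} (ha₂ : cuspCoeff f₀ 2 = a₂)
    (h18 : ‖((ratPlusSymbol f₀ (1 / 8) : ℚ) : ℚ_[2])‖ = 1)
    (hZ0 : ∃ L : ℂ → ℂ, Differentiable ℂ L ∧ (∀ s : ℂ, 2 < s.re → L s = cuspFormLSeries f₀ s) ∧
      L 1 = 0)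
    (hZ4 : ∃ L : ℂ → ℂ, Differentiable ℂ L ∧
      (∀ s : ℂ, 2 < s.re → L s = twistedLSeries f₀ (ZMod.χ₄.ringHomComp (Int.castRingHom ℂ)) s) ∧
      L 1 = 0)
    (hZ8 : ∃ L : ℂ → ℂ, Differentiable ℂ L ∧
      (∀ s : ℂ, 2 < s.re → L s = twistedLSeries f₀ (ZMod.χ₈'.ringHomComp (Int.castRingHom ℂ)) s) ∧
      L 1 = 0)
    (hZ4F : ∃ L : ℂ → ℂ, Differentiable ℂ L ∧
      (∀ s : ℂ, 2 < s.re → L s = twistedLSeries (charTwist (W.conductorNorm ℤ) hN hm hχ f₀)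
        (ZMod.χ₄.ringHomComp (Int.castRingHom ℂ)) s) ∧ L 1 = 0)
    (hZ8F : ∃ L : ℂ → ℂ, Differentiable ℂ L ∧
      (∀ s : ℂ, 2 < s.re → L s = twistedLSeries (charTwist (W.conductorNorm ℤ) hN hm hχ f₀)
        (ZMod.χ₈'.ringHomComp (Int.castRingHom ℂ)) s) ∧ L 1 = 0)
    (hΛ : ∀ z ∈ periodLattice f₀, z.im = 0 → ∃ k : ℤ, z = k * (plusPeriod f₀ : ℂ)) :
    (padicLFunction (charTwist (W.conductorNorm ℤ) hN hm hχ f₀) (unitRoot W 2 : ℚ_[2])).order = 2 :=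
  order_padicLFunction_eq_two_of_twistedEighth_forcedZeros' hN hm hχ hχe hχp hf₀ hQ₀ hN2 hL2 hord hF hw
    hL hper hq hq2 hqN ha hodd ha₂ h18 (modularSymbol_zero_eq_zero_of_LValue f₀ hZ0)
    (modularSymbol_quarters_eq_zero_of_twistedLValue_χ₄ f₀ hZ4)
    (modularSymbol_eighths_eq_zero_of_twistedLValue_χ₈' f₀ hZ8)
    (modularSymbol_quarters_eq_zero_of_twistedLValue_χ₄ _ hZ4F)
    (modularSymbol_eighths_eq_zero_of_twistedLValue_χ₈' _ hZ8F) hΛ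

/-- **The door with analytic inputs + descent (no Kato).** [cite: MazurTateTeitelbaum1986Invent, §I.8, §I.14]
[cite: Greenberg1999LNM, §1 pp. 54–57] -/
theorem twoAdicBSD_rank_of_twistedEighth_analytic_descent
    (hN : N₀ ∣ W.conductorNorm ℤ) (hm : q ^ 2 ∣ W.conductorNorm ℤ)
    {χ : DirichletCharacter ℂ q} (hχ : χ.IsQuadratic) (hχe : χ.Even) (hχp : χ.IsPrimitive)
    {f₀ : CuspForm (Gamma0 N₀) 2} (hf₀ : IsNewform0 f₀) (hQ₀ : coeffField f₀ = ⊥) (hN2 : ¬ 2 ∣ N₀)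
    (hL2 : ¬ 2 ∣ W.conductorNorm ℤ) (hord : IsOrdinaryAt W 2)
    (hF : IsNewformOf W (charTwist (W.conductorNorm ℤ) hN hm hχ f₀))
    (hw : W.rootNumber = 1) (hL : W.entireLFunction 1 = 0)
    (hper : ∃ u : ℚ, ‖(u : ℚ_[2])‖ = 1 ∧
      (u : ℂ) * (plusPeriod (charTwist (W.conductorNorm ℤ) hN hm hχ f₀) : ℂ) *
        gaussSum χ (ZMod.stdAddChar (N := q)) = (plusPeriod f₀ : ℂ))
    (hq : q.Prime) (hq2 : q ≠ 2) (hqN : ¬ q ∣ N₀) {a : ℤ} (ha : cuspCoeff f₀ q = a) (hodd : Odd a)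
    {a₂ : ℤ} (ha₂ : cuspCoeff f₀ 2 = a₂)
    (h18 : ‖((ratPlusSymbol f₀ (1 / 8) : ℚ) : ℚ_[2])‖ = 1)
    (hZ0 : ∃ L : ℂ → ℂ, Differentiable ℂ L ∧ (∀ s : ℂ, 2 < s.re → L s = cuspFormLSeries f₀ s) ∧
      L 1 = 0)
    (hZ4 : ∃ L : ℂ → ℂ, Differentiable ℂ L ∧
      (∀ s : ℂ, 2 < s.re → L s = twistedLSeries f₀ (ZMod.χ₄.ringHomComp (Int.castRingHom ℂ)) s) ∧
      L 1 = 0)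
    (hZ8 : ∃ L : ℂ → ℂ, Differentiable ℂ L ∧
      (∀ s : ℂ, 2 < s.re → L s = twistedLSeries f₀ (ZMod.χ₈'.ringHomComp (Int.castRingHom ℂ)) s) ∧
      L 1 = 0)
    (hZ4F : ∃ L : ℂ → ℂ, Differentiable ℂ L ∧
      (∀ s : ℂ, 2 < s.re → L s = twistedLSeries (charTwist (W.conductorNorm ℤ) hN hm hχ f₀)
        (ZMod.χ₄.ringHomComp (Int.castRingHom ℂ)) s) ∧ L 1 = 0)
    (hZ8F : ∃ L : ℂ → ℂ, Differentiable ℂ L ∧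
      (∀ s : ℂ, 2 < s.re → L s = twistedLSeries (charTwist (W.conductorNorm ℤ) hN hm hχ f₀)
        (ZMod.χ₈'.ringHomComp (Int.castRingHom ℂ)) s) ∧ L 1 = 0)
    (hΛ : ∀ z ∈ periodLattice f₀, z.im = 0 → ∃ k : ℤ, z = k * (plusPeriod f₀ : ℂ))
    (hrank : W.mordellWeilRank = 2) (hsha : W.shaCorank 2 = 0) :
    W.selmerCorank 2 = 2 ∧
      (padicLFunction (charTwist (W.conductorNorm ℤ) hN hm hχ f₀) (unitRoot W 2 : ℚ_[2])).order = 2 ∧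
      W.mordellWeilRank = 2 :=
  twoAdicBSD_rank_of_twistedEighth_descent hN hm hχ hχe hχp hf₀ hQ₀ hN2 hL2 hord hF hw hL hper hq hq2
    hqN ha hodd ha₂ h18 (modularSymbol_zero_eq_zero_of_LValue f₀ hZ0)
    (modularSymbol_quarters_eq_zero_of_twistedLValue_χ₄ f₀ hZ4)
    (modularSymbol_eighths_eq_zero_of_twistedLValue_χ₈' f₀ hZ8)
    (modularSymbol_quarters_eq_zero_of_twistedLValue_χ₄ _ hZ4F)
    (modularSymbol_eighths_eq_zero_of_twistedLValue_χ₈' _ hZ8F) hΛ hrank hsha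

end TwistDoorConductorLevel

section TwistDoorAnalyticAnyLevel

variable {N₀ : ℕ} [NeZero N₀] {q : ℕ} [NeZero q] (L : ℕ) [NeZero L]
variable {W : WeierstrassCurve ℚ} [W.IsElliptic] [W.IsGloballyMinimal]

/-- **The equality door with analytic inputs (any level; Kato + planted rank).** As
`rank_eq_two_of_twistedEighth_forcedZeros'` with the five symbol hypotheses replaced by the central
vanishings `L(f₀,1) = 0`, `L(f₀,χ₋₄,1) = L(f₀,χ₋₈,1) = L(F,χ₋₄,1) = L(F,χ₋₈,1) = 0`.
[cite: MazurTateTeitelbaum1986Invent, §I.8 (8.6), §I.14] [cite: Kato2004, Thm 17.4] [cite: Birch1971] -/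
theorem rank_eq_two_of_twistedEighth_analytic (hN : N₀ ∣ L) (hm : q ^ 2 ∣ L)
    {χ : DirichletCharacter ℂ q} (hχ : χ.IsQuadratic) (hχe : χ.Even) (hχp : χ.IsPrimitive)
    {f₀ : CuspForm (Gamma0 N₀) 2} (hf₀ : IsNewform0 f₀) (hQ₀ : coeffField f₀ = ⊥) (hN2 : ¬ 2 ∣ N₀)
    (hL2 : ¬ 2 ∣ L) (hord : IsOrdinaryAt W 2) (hF : IsNewformOf W (charTwist L hN hm hχ f₀))
    (hper : ∃ u : ℚ, ‖(u : ℚ_[2])‖ = 1 ∧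
      (u : ℂ) * (plusPeriod (charTwist L hN hm hχ f₀) : ℂ) * gaussSum χ (ZMod.stdAddChar (N := q)) =
        (plusPeriod f₀ : ℂ))
    (hq : q.Prime) (hq2 : q ≠ 2) (hqN : ¬ q ∣ N₀) {a : ℤ} (ha : cuspCoeff f₀ q = a) (hodd : Odd a)
    {a₂ : ℤ} (ha₂ : cuspCoeff f₀ 2 = a₂)
    (h18 : ‖((ratPlusSymbol f₀ (1 / 8) : ℚ) : ℚ_[2])‖ = 1)
    (hZ0 : ∃ Λ : ℂ → ℂ, Differentiable ℂ Λ ∧ (∀ s : ℂ, 2 < s.re → Λ s = cuspFormLSeries f₀ s) ∧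
      Λ 1 = 0)
    (hZ4 : ∃ Λ : ℂ → ℂ, Differentiable ℂ Λ ∧
      (∀ s : ℂ, 2 < s.re → Λ s = twistedLSeries f₀ (ZMod.χ₄.ringHomComp (Int.castRingHom ℂ)) s) ∧
      Λ 1 = 0)
    (hZ8 : ∃ Λ : ℂ → ℂ, Differentiable ℂ Λ ∧
      (∀ s : ℂ, 2 < s.re → Λ s = twistedLSeries f₀ (ZMod.χ₈'.ringHomComp (Int.castRingHom ℂ)) s) ∧
      Λ 1 = 0)
    (hZ4F : ∃ Λ : ℂ → ℂ, Differentiable ℂ Λ ∧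
      (∀ s : ℂ, 2 < s.re → Λ s = twistedLSeries (charTwist L hN hm hχ f₀)
        (ZMod.χ₄.ringHomComp (Int.castRingHom ℂ)) s) ∧ Λ 1 = 0)
    (hZ8F : ∃ Λ : ℂ → ℂ, Differentiable ℂ Λ ∧
      (∀ s : ℂ, 2 < s.re → Λ s = twistedLSeries (charTwist L hN hm hχ f₀)
        (ZMod.χ₈'.ringHomComp (Int.castRingHom ℂ)) s) ∧ Λ 1 = 0)
    (hΛ : ∀ z ∈ periodLattice f₀, z.im = 0 → ∃ k : ℤ, z = k * (plusPeriod f₀ : ℂ))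
    (hKato : kato_selmerCorank_le_order_padicLFunction_allPrimes W 2 (f := charTwist L hN hm hχ f₀))
    (hrank : 2 ≤ W.mordellWeilRank) :
    W.mordellWeilRank = 2 ∧ W.selmerCorank 2 = 2 ∧ W.shaCorank 2 = 0 ∧
      (padicLFunction (charTwist L hN hm hχ f₀) (unitRoot W 2 : ℚ_[2])).order = (2 : ℕ) :=
  rank_eq_two_of_twistedEighth_forcedZeros' L hN hm hχ hχe hχp hf₀ hQ₀ hN2 hL2 hord hF hper hq hq2 hqN
    ha hodd ha₂ h18 (modularSymbol_zero_eq_zero_of_LValue f₀ hZ0)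
    (modularSymbol_quarters_eq_zero_of_twistedLValue_χ₄ f₀ hZ4)
    (modularSymbol_eighths_eq_zero_of_twistedLValue_χ₈' f₀ hZ8)
    (modularSymbol_quarters_eq_zero_of_twistedLValue_χ₄ _ hZ4F)
    (modularSymbol_eighths_eq_zero_of_twistedLValue_χ₈' _ hZ8F) hΛ hKato hrank

end TwistDoorAnalyticAnyLevel

end Summit.BirchSwinnertonDyer.Rank2

end
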